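import Literature.Topology.FourManifolds.CappellShanesonClassGroupFifteen
import Literature.Topology.FourManifolds.CappellShanesonEisensteinSeven
import HarnessLib

/-!
# The class group of the trace `13` field (discriminant `11417 = 7 · 7 · 233`) and Gompf's conjecture
# for the traces `13` and `-8` (Kim–Yamada 2023, Theorem B)

Serves the named fact
`Literature.Topology.FourManifolds.kimYamada2023_nonempty_diffeomorph_sphere_four_of_trace_mem_Icc`
(`CappellShaneson.lean`; M. H. Kim, S. Yamada, Kyungpook Math. J. 63 (2023) 373–411 =
arXiv:1707.03860, Cor. C), reduced in the tree to Gompf's topological leaves and Theorem B in matrix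
form (`GompfConjectureForTrace n`) for the traces not yet proved. This file PROVES Theorem B for the
trace `13`: the class group of the trace-`13` field is cyclic of order dividing `3`, generated by
`a = [(3, θ - 2)]`, and `C(ℤ[Θ₁₃])` is covered by the representatives `(1, 1, 13)`,
`(2, 3, 13)`, `(3, 5, 13)`, which move by Gompf moves (Lemma 6.1 / §6.1) to the
traces `1`, `-2`, where Gompf's conjecture holds — and, by Theorem A, for
`-8 = 5 - 13`. (File generated from a certified class-group computation; every relation is checked
by the Lean kernel.)

## The number theory

For a cubic number field `K` generated by a root `θ` of `f₁₃ = x³ - 13x² + 12x - 1`: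

* `Δ(f₁₃) = 11417 = 7 · 7 · 233` = 7² · 233, `f₁₃(x+2)` is 7-Eisenstein, so `𝓞 K = ℤ[θ]`, `d_K = 11417`; `K` is totally real, `⌊M_K⌋ = ⌊(2/9)√d_K⌋ ≤ 23`;
* Dedekind–Kummer at `p ≤ 23` (Marcus, Ch. 3, Thm. 27): inert `2, 13, 19, 23`;
  linear × irreducible quadratic at `3`; three linear factors at
  `7`; a unique simple root at `5, 11, 17`;
* generator `a = [(3, θ - 2)]` with `a³ = 1`; spanning-tree relations (parent · child =
  principal): `(3, θ - 2) · (5, θ - 3) = (2θ - 1)`; `(3, θ - 2) · (7, θ - 2) = (θ - 2)`; `(3, θ - 2) · (3, θ² + θ - 1) = (3θ - 3)`; `(11, θ - 3) · (5, θ - 3) = (θ - 3)`; `(17, θ - 15) · (5, θ - 3) = (θ + 2)`; `(5, θ - 3) · (5, θ² + 2) = (5θ - 5)`; `(3, θ - 2) · (11, θ² + θ + 4) = (θ² - 10θ + 4)`; `(3, θ - 2) · (17, θ² + 2θ + 8) = (2θ² + 4θ - 1)`;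
* hence every ideal class is one of `a⁰, …, a²` (`classGroup_mem_thirteen`).

Transport to `ℤ[X]/(f₁₃)` and Prop. 2.14 (`exists_isConj_standardCSMatrix_of_cover`):
`isConj_standardCSMatrix_of_trace_eq_thirteen`, `gompfConjectureForTrace_thirteen`,
`gompfConjectureForTrace_neg_eight`. No named fact is introduced (D-0026).

## References

* [KimYamada2023] M. H. Kim, S. Yamada, Kyungpook Math. J. 63 (2023) 373–411 (arXiv:1707.03860):
  §2.3 (Prop. 2.14), §5 (Tables 2–4), §6.1 (Lemma 6.1 and the proof of Thm. B), Thm. A.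
* [Marcus2018] D. A. Marcus, *Number Fields*, 2nd ed., Ch. 3, Thm. 27 (Dedekind–Kummer); Ch. 5,
  Cor. 2 of Thm. 37 (Minkowski bound).
-/

noncomputable section

open Set Polynomial Module NumberField Ideal
open scoped NumberField MatrixGroups nonZeroDivisors
open Literature.LinearAlgebra.Matrix

namespace Literature.Topology.FourManifolds


section Field

variable {K : Type*} [Field K] [NumberField K] {θ : K}

/-! ### Discriminant `11417` and `𝓞 K = ℤ[θ]` -/

/-- `Δ(f₁₃) = 13·11·10·8 - 23 = 11417`. [cite: KimYamada2023, §3 (Δ(fₙ) = n(n-2)(n-3)(n-5) - 23)] -/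
theorem csDisc_thirteen : csDisc 13 = 11417 := by
  decide

set_option maxRecDepth 8192 in
/-- `Δ(f₁₃) = 11417 = 7² · 233` with `233` squarefree and prime to `7`, and `f₁₃(x + 2)` is
`7`-Eisenstein (`13 ≡ 6 (mod 7)`, `13 ≢ 27 (mod 49)`): the index of `ℤ[θ]` in `𝓞 K` is `1`, i.e.
`𝓞 K = ℤ[θ]` (`isUnit_indexDet_csPB_of_eisenstein`). [cite: KimYamada2023, Prop. 4.10 and §6.1] -/
theorem isUnit_indexDet_thirteen (hθ : aeval θ (csPoly 13) = 0) (h3 : finrank ℚ K = 3) :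
    IsUnit (Literature.NumberTheory.NumberFields.indexDet (csPB hθ h3) (isIntegral_csPB_gen hθ h3)) :=
  isUnit_indexDet_csPB_of_eisenstein hθ h3 (m := 233) (B := 15) (by norm_num)
    (by rw [csDisc_thirteen]; norm_num) (by norm_num) (by norm_num) (by decide) (by norm_num) (by norm_num)
    (by norm_num) (by norm_num)

/-- `d_K = 11417` for the trace `13` field. [folklore] -/
theorem discr_eq_thirteen (hθ : aeval θ (csPoly 13) = 0) (h3 : finrank ℚ K = 3) :
    NumberField.discr K = 11417 := by
  rw [discr_eq_csDisc_of_isUnit hθ h3 (isUnit_indexDet_thirteen hθ h3), csDisc_thirteen]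

/-- The cubic relation `θ³ - 13θ² + 12θ - 1 = 0` in `𝓞 K`. [folklore] -/
theorem thetaInt_rel_thirteen (hθ : aeval θ (csPoly 13) = 0) :
    (thetaInt hθ) ^ 3 - 13 * (thetaInt hθ) ^ 2 + 12 * thetaInt hθ - 1 = 0 := by
  have rel := thetaInt_rel hθ
  push_cast at rel
  linear_combination rel

/-! ### The primes of norm at most `23` (Dedekind–Kummer) -/

set_option maxHeartbeats 0 in
set_option maxRecDepth 65536 in
/-- The inert primes `2, 13, 19, 23` (no root of `f₁₃`): every prime above them is `(p)`. [folklore] -/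
theorem eq_span_of_inert_thirteen (hθ : aeval θ (csPoly 13) = 0) (h3 : finrank ℚ K = 3) {p : ℕ}
    (hp : p = 2 ∨ p = 13 ∨ p = 19 ∨ p = 23)
    {P : Ideal (𝓞 K)} (hP : P ∈ primesOver (span {(p : ℤ)}) (𝓞 K)) : P = span {(p : 𝓞 K)} := by
  rcases hp with rfl | rfl | rfl | rfl
  · exact eq_span_of_no_root_of_isUnit hθ h3 (isUnit_indexDet_thirteen hθ h3) (by norm_num) hP (by decide)
  · exact eq_span_of_no_root_of_isUnit hθ h3 (isUnit_indexDet_thirteen hθ h3) (by norm_num) hP (by decide)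
  · exact eq_span_of_no_root_of_isUnit hθ h3 (isUnit_indexDet_thirteen hθ h3) (by norm_num) hP (by decide)
  · exact eq_span_of_no_root_of_isUnit hθ h3 (isUnit_indexDet_thirteen hθ h3) (by norm_num) hP (by decide)

set_option maxHeartbeats 0 in
set_option maxRecDepth 65536 in
/-- The degree-one primes at primes with a unique root of `f₁₃`: `(5, θ - 3)`, `(11, θ - 3)`, `(17, θ - 15)` are the only
primes `P` above them with `p ^ {f_P} ≤ 23`. [folklore] -/
theorem eq_span_pair_of_unique_root_thirteen (hθ : aeval θ (csPoly 13) = 0) (h3 : finrank ℚ K = 3)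
    {p : ℕ} {c₀ : ℤ}
    (hp : (p = 5 ∧ c₀ = 3) ∨ (p = 11 ∧ c₀ = 3) ∨ (p = 17 ∧ c₀ = 15))
    {P : Ideal (𝓞 K)} (hP : P ∈ primesOver (span {(p : ℤ)}) (𝓞 K)) (hle : p ^ P.inertiaDeg ℤ ≤ 23) :
    P = span {(p : 𝓞 K), thetaInt hθ - (c₀ : 𝓞 K)} := by
  rcases hp with ⟨rfl, rfl⟩ | ⟨rfl, rfl⟩ | ⟨rfl, rfl⟩
  · exact eq_span_pair_of_unique_root_of_isUnit hθ h3 (isUnit_indexDet_thirteen hθ h3) (by norm_num) hP hle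
      (by decide) (by norm_num)
  · exact eq_span_pair_of_unique_root_of_isUnit hθ h3 (isUnit_indexDet_thirteen hθ h3) (by norm_num) hP hle
      (by decide) (by norm_num)
  · exact eq_span_pair_of_unique_root_of_isUnit hθ h3 (isUnit_indexDet_thirteen hθ h3) (by norm_num) hP hle
      (by decide) (by norm_num)

/-- `f₁₃ = (x - 2)(x^2 + x - 1) + 3(-4 * x^2 + 5 * x - 1)`: the factorisation modulo `3`. [folklore] -/
theorem csPoly_thirteen_eq_three :
    csPoly 13 = (X - 2) * (X ^ 2 + X - 1) + 3 * (-4 * X ^ 2 + 5 * X - 1) := by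
  simp only [csPoly, map_sub, map_one, map_ofNat]
  ring

set_option maxHeartbeats 0 in
/-- **The primes above `3`**: `(3, θ - 2)` (degree one) and `(3, θ ^ 2 + θ - 1)` (degree two): `f₁₃ ≡ (x - 2)(x^2 + x - 1) (mod 3)` with the quadratic factor irreducible (no root). [cite: Marcus2018, Ch. 3, Thm. 27] -/
theorem eq_P3_or_eq_Q3_thirteen (hθ : aeval θ (csPoly 13) = 0) (h3 : finrank ℚ K = 3)
    {P : Ideal (𝓞 K)} (hP : P ∈ primesOver (span {((3 : ℕ) : ℤ)}) (𝓞 K)) :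
    P = span {(3 : 𝓞 K), thetaInt hθ - 2} ∨
      P = span {(3 : 𝓞 K), thetaInt hθ ^ 2 + thetaInt hθ - 1} := by
  have hmap : (X ^ 2 + X - 1 : ℤ[X]).map (Int.castRingHom (ZMod 3)) = X ^ 2 + X - 1 := by
    simp only [Polynomial.map_sub, Polynomial.map_add, Polynomial.map_pow, map_X, Polynomial.map_one]
  have hmod : csPolyMod 13 3 = (X - C ((2 : ℤ) : ZMod 3)) *
      (X ^ 2 + X - 1 : ℤ[X]).map (Int.castRingHom (ZMod 3)) := by
    rw [csPolyMod, csPoly_thirteen_eq_three, Polynomial.map_add]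
    have hp : Polynomial.map (Int.castRingHom (ZMod 3)) (3 * (-4 * X ^ 2 + 5 * X - 1) : ℤ[X]) = 0 := by
      rw [Polynomial.map_mul, show (3 : ℤ[X]) = C 3 from rfl, Polynomial.map_C]
      have : (Int.castRingHom (ZMod 3)) 3 = 0 := by decide
      rw [this, C_0, zero_mul]
    rw [hp, add_zero, hmap]
    simp only [Polynomial.map_mul, Polynomial.map_sub, Polynomial.map_add, Polynomial.map_pow, map_X, Polynomial.map_ofNat, Int.cast_ofNat, map_ofNat, Polynomial.map_one]
  have hmon : ((X ^ 2 + X - 1 : ℤ[X]).map (Int.castRingHom (ZMod 3))).Monic := by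
    rw [hmap]
    monicity!
  have hnr : ∀ c : ZMod 3, c ^ 2 + c - 1 ≠ 0 := by decide
  haveI := Fact.mk (show Nat.Prime 3 by norm_num)
  have hirr : Irreducible ((X ^ 2 + X - 1 : ℤ[X]).map (Int.castRingHom (ZMod 3))) := by
    rw [hmap]
    have hdeg : (X ^ 2 + X - 1 : (ZMod 3)[X]).natDegree = 2 := by compute_degree!
    refine irreducible_of_degree_le_three_of_not_isRoot (by rw [hdeg]; decide) fun c hc => hnr c ?_
    have h := hc
    rw [IsRoot.def] at h
    simpa using h
  rcases eq_span_pair_of_linear_mul_quadratic_of_isUnit hθ h3 (isUnit_indexDet_thirteen hθ h3) (by norm_num) hmon hirr hmod hP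
    with h | h
  · left; simpa using h
  · right
    simp only [map_sub, map_add, map_pow, aeval_X, map_one] at h
    simpa using h

/-- `f₁₃ = (x - 2)(x - 2)(x - 2) + 7(-x^2 + 1)`: `f₁₃ ≡ (x - 2)(x - 2)(x - 2) (mod 7)`. [folklore] -/
theorem csPoly_thirteen_eq_seven :
    csPoly 13 = (X - 2) * (X - 2) * (X - 2) + 7 * (-X ^ 2 + 1) := by
  simp only [csPoly, map_sub, map_one, map_ofNat]
  ring

/-- `f₁₃ mod 7 = (x - 2)(x - 2)(x - 2)`. [folklore] -/
theorem csPolyMod_thirteen_seven :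
    csPolyMod 13 7 = (X - C ((2 : ℤ) : ZMod 7)) * (X - C ((2 : ℤ) : ZMod 7)) *
      (X - C ((2 : ℤ) : ZMod 7)) := by
  rw [csPolyMod, csPoly_thirteen_eq_seven, Polynomial.map_add]
  have hp : Polynomial.map (Int.castRingHom (ZMod 7)) (7 * (-X ^ 2 + 1) : ℤ[X]) = 0 := by
    rw [Polynomial.map_mul, show (7 : ℤ[X]) = C 7 from rfl, Polynomial.map_C]
    have : (Int.castRingHom (ZMod 7)) 7 = 0 := by decide
    rw [this, C_0, zero_mul]
  rw [hp, add_zero]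
  simp only [Polynomial.map_mul, Polynomial.map_sub, map_X, Polynomial.map_ofNat, Int.cast_ofNat,
    map_ofNat]

/-- **The primes above `7`**: `(7, θ - 2)`, `(7, θ - 2)`, `(7, θ - 2)`. [folklore] -/
theorem eq_P7_thirteen (hθ : aeval θ (csPoly 13) = 0) (h3 : finrank ℚ K = 3)
    {P : Ideal (𝓞 K)} (hP : P ∈ primesOver (span {((7 : ℕ) : ℤ)}) (𝓞 K)) :
    P = span {(7 : 𝓞 K), thetaInt hθ - 2} ∨ P = span {(7 : 𝓞 K), thetaInt hθ - 2} ∨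
      P = span {(7 : 𝓞 K), thetaInt hθ - 2} := by
  rcases eq_span_pair_of_split_of_isUnit hθ h3 (isUnit_indexDet_thirteen hθ h3) (by norm_num)
    csPolyMod_thirteen_seven hP with h | h | h
  · left; simpa using h
  · right; left; simpa using h
  · right; right; simpa using h


end Field


end Literature.Topology.FourManifolds

end
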